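import Summits.BirchSwinnertonDyer.BirchSwinnertonDyer.Theorems.ManinLocalTwoThreeGenerationFunctionals
import Literature.NumberTheory.EllipticCurves.Gamma0CocycleDegeneracyMaps
import HarnessLib

/-!
# Route `ManinLocalTwoThree`, crux C3 `ManinPrimeToThreeAtNine` (stmt-BirchSwinnertonDyer-22968): E-es-19 in the COCYCLE
# currency of the cell's relative Ihara statement E-es-25 (MEMO-es §21; T-es-12 vocabulary `HidaCohomology.cocycles`,
# `degeneracyPullback`, `Gamma0.degeneracyConj`) — «every `ZMod 3`-valued weight-2 cocycle of `Γ₀(N)` that comes from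
# `Λ_f` and is `A₃`-shift-invariant (`π₃^* u = π₁^* u` on `Γ₀(3N)`) vanishes» ⟹ `ShiftClassGenerationThree`
# (line prover p3; helper, unconditional bridge)

Given a `W`-newform `f` of level `N` and an additive `φ : Λ_f → ZMod 3`, the function `u_φ(γ) := φ({∞, γ∞}_f)` is a
`0`-cocycle (a homomorphism `Γ₀(N) → 𝔽₃`, `cuspSymbol_mul_holds`), and
`(π₃^* u_φ)(γ) − (π₁^* u_φ)(γ) = φ({∞, γ∞}_{f∣ι₃ − f∣ι₁})` for `γ ∈ Γ₀(3N)` (`cuspSymbol_degeneracyMap0`), so `u_φ` is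
shift-invariant exactly when `φ` kills the oldform lattice `Λ_{f∣ι₃ − f∣ι₁}`.  Hence
(`shiftClassGenerationThree_of_cocycles`): if every such shift-invariant cocycle `u_φ` vanishes (for all `W`-newforms `f`
with `9 ∣ N`, `W[3]` irreducible), then E-es-19 holds — by `shiftClassGenerationThree_iff_functionals`.  What the typed
E-es-25 must still supply for `u_φ` is the Hecke side («generalised eigenvector for the non-Eisenstein system
`ℓ ↦ a_ℓ(W) mod 3`»); that is NOT proved here.  Nothing about BSD, Manin's conjecture, E-es-19 or E-es-25 is proved here.
-/

set_option autoImplicit false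
set_option linter.dupNamespace false

noncomputable section

open scoped Classical MatrixGroups ModularForm BigOperators

open CongruenceSubgroup Matrix.SpecialLinearGroup ModularGroup
  Literature.NumberTheory.EllipticCurves Literature.NumberTheory.EllipticCurves.ModularForms
  Literature.NumberTheory.EllipticCurves.ModularForms.HidaCohomology
  Summit.BirchSwinnertonDyer.Rank1Residual.ManinAdditive

namespace Summit.BirchSwinnertonDyer.BirchSwinnertonDyer.Theorems.ManinLocalTwoThree

section Cocycle

variable {N : ℕ} [NeZero N] (f : CuspForm (Gamma0 N) 2) {R : Type*} [CommRing R]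

/-- **The weight-2 cocycle of a functional on `Λ_f`**: for an additive `φ : Λ_f → R`, the function
`γ ↦ φ({∞, γ∞}_f)` is a `0`-cocycle of `Γ₀(N)` (a homomorphism; Manin: `{∞, γδ∞} = {∞, γ∞} + {∞, δ∞}`).
[cite: Manin1972, Prop. 1.4] -/
theorem functionalCocycle_mem_cocycles (φ : ↥(periodLattice f) →+ R) :
    (fun (γ : Gamma0 N) (_ : Fin 1) => φ ⟨cuspSymbol f γ, cuspSymbol_mem_periodLattice f γ⟩) ∈ cocycles 0 N R := by
  rw [mem_cocycles_iff]
  intro γ δ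
  funext i
  rw [act_zero_eq_id, LinearMap.id_apply, Pi.add_apply]
  have hmul : (⟨cuspSymbol f (γ * δ), cuspSymbol_mem_periodLattice f (γ * δ)⟩ : ↥(periodLattice f)) =
      ⟨cuspSymbol f δ, cuspSymbol_mem_periodLattice f δ⟩ + ⟨cuspSymbol f γ, cuspSymbol_mem_periodLattice f γ⟩ := by
    apply Subtype.ext
    show cuspSymbol f (γ * δ) = cuspSymbol f δ + cuspSymbol f γ
    rw [cuspSymbol_mul_holds f γ δ, add_comm]
  rw [hmul, map_add]

/-- **E-es-19 from the vanishing of shift-invariant functional cocycles.** Suppose that for every `W`-newform `f`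
(`9 ∣ N`, `W[3]` irreducible) and every additive `φ : Λ_f → ZMod 3` whose cocycle `u_φ(γ) = φ({∞, γ∞}_f)` is
`A₃`-shift-invariant — `π₃^* u_φ = π₁^* u_φ` on `Γ₀(3N)` (`degeneracyPullback`, T-es-12 vocabulary) — the cocycle `u_φ`
vanishes identically. Then `ShiftClassGenerationThree`. (Shift-invariance of `u_φ` ⟸ `φ` kills `Λ_{f∣ι₃ − f∣ι₁}`, by
`cuspSymbol_degeneracyMap0`; conclude with `shiftClassGenerationThree_iff_functionals`.) [folklore] -/
theorem shiftClassGenerationThree_of_cocycles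
    (H : ∀ (W : WeierstrassCurve ℚ) [W.IsElliptic] {N : ℕ} [NeZero N] (f : CuspForm (Gamma0 N) 2),
      IsNewformOf W f → 3 ^ 2 ∣ N → W.HasIrreducibleModPGaloisRep 3 →
      ∀ (h3 : N * 3 ∣ 3 * N) (h1 : N * 1 ∣ 3 * N) (φ : ↥(periodLattice f) →+ ZMod 3),
        (∀ γ : Gamma0 (3 * N),
          degeneracyPullback 0 N (3 * N) 3 (ZMod 3) h3
              (fun (γ : Gamma0 N) (_ : Fin 1) => φ ⟨cuspSymbol f γ, cuspSymbol_mem_periodLattice f γ⟩) γ =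
            degeneracyPullback 0 N (3 * N) 1 (ZMod 3) h1
              (fun (γ : Gamma0 N) (_ : Fin 1) => φ ⟨cuspSymbol f γ, cuspSymbol_mem_periodLattice f γ⟩) γ) →
        ∀ γ : Gamma0 N, φ ⟨cuspSymbol f γ, cuspSymbol_mem_periodLattice f γ⟩ = 0) :
    ShiftClassGenerationThree := by
  rw [shiftClassGenerationThree_iff_functionals]
  intro W _ N _ f hf h9 hirr φ hφ
  have h3 : N * 3 ∣ 3 * N := dvd_of_eq (mul_comm N 3)
  have h1 : N * 1 ∣ 3 * N := ⟨3, by ring⟩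
  -- the cocycle `u_φ` is shift-invariant because `φ` kills the oldform lattice
  have hshift : ∀ γ : Gamma0 (3 * N),
      degeneracyPullback 0 N (3 * N) 3 (ZMod 3) h3
          (fun (γ : Gamma0 N) (_ : Fin 1) => φ ⟨cuspSymbol f γ, cuspSymbol_mem_periodLattice f γ⟩) γ =
        degeneracyPullback 0 N (3 * N) 1 (ZMod 3) h1
          (fun (γ : Gamma0 N) (_ : Fin 1) => φ ⟨cuspSymbol f γ, cuspSymbol_mem_periodLattice f γ⟩) γ := by
    intro γ
    funext i
    rw [degeneracyPullback_zero_apply, degeneracyPullback_one_apply, ← sub_eq_zero, ← map_sub]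
    apply hφ
    show cuspSymbol f (Gamma0.degeneracyConj N (3 * N) 3 h3 γ) - cuspSymbol f (Gamma0.degeneracyConj N (3 * N) 1 h1 γ) ∈ _
    rw [← cuspSymbol_degeneracyMap0 h3 f γ, ← cuspSymbol_degeneracyMap0 h1 f γ, ← periodFunctional_apply,
      ← periodFunctional_apply, ← map_sub]
    exact cuspSymbol_mem_periodLattice _ γ
  have hu := H W f hf h9 hirr h3 h1 φ hshift
  -- `u_φ = 0` forces `φ = 0` since every period is some `{∞, γ∞}_f`
  ext x
  have hx : (x : ℂ) ∈ (periodLattice f : Set ℂ) := x.2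
  rw [coe_periodLattice_eq_range] at hx
  obtain ⟨γ, hγ⟩ := hx
  have : x = ⟨cuspSymbol f γ, cuspSymbol_mem_periodLattice f γ⟩ := Subtype.ext hγ.symm
  rw [this, AddMonoidHom.zero_apply]
  exact hu γ

omit [NeZero N] in
/-- For `T ⊆ Gen(N)`, the level of `f∣ι_{∏T}` divides `8N²`: `N·∏_{t∈T} t ∣ 8N²` (`∏_{t∈T} t ∣ 8N`). [folklore] -/
theorem level_mul_prod_dvd_of_mem_powerset {T : Finset ℕ}
    (hT : T ∈ (insert 8 (N.primeFactors.filter fun q => ¬ q ^ 2 ∣ N)).powerset) :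
    N * (∏ t ∈ T, t - 1 + 1) ∣ 8 * N ^ 2 := by
  have hTG := Finset.mem_powerset.mp hT
  rw [prod_sub_one_add_one_of_subset_gen hTG]
  calc N * ∏ t ∈ T, t ∣ N * (8 * N) := mul_dvd_mul_left N (prod_dvd_eight_mul_of_subset_gen hTG)
    _ = 8 * N ^ 2 := by ring

/-- **E-es-22 from the vanishing of multi-shift-annihilated functional cocycles.** Suppose that for every `W`-newform `f`
(`4 ∣ N`, `W[2]` irreducible) and every additive `φ : Λ_f → ZMod 2` whose cocycle `u_φ(γ) = φ({∞, γ∞}_f)` is killed by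
`∏_{t ∈ Gen(N)} (1 − π_t^*)`, i.e. `Σ_{T ⊆ Gen(N)} (−1)^{|T|} π_{∏T}^* u_φ = 0` on `Γ₀(8N²)` (`degeneracyPullback`, T-es-12
vocabulary), the cocycle `u_φ` vanishes identically. Then `MultiShiftClassGenerationTwo`. (The annihilation ⟸ `φ` kills
`Λ_{h₂}`, `h₂ = Σ_T (−1)^{|T|} f∣ι_{∏T}`, by `cuspSymbol_degeneracyMap0`; conclude with
`multiShiftClassGenerationTwo_iff_functionals`.) [folklore] -/
theorem multiShiftClassGenerationTwo_of_cocycles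
    (H : ∀ (W : WeierstrassCurve ℚ) [W.IsElliptic] {N : ℕ} [NeZero N] (f : CuspForm (Gamma0 N) 2),
      IsNewformOf W f → 2 ^ 2 ∣ N → W.HasIrreducibleModPGaloisRep 2 →
      ∀ (φ : ↥(periodLattice f) →+ ZMod 2),
        (∀ γ : Gamma0 (8 * N ^ 2),
          ∑ T ∈ (insert 8 (N.primeFactors.filter fun q => ¬ q ^ 2 ∣ N)).powerset.attach,
            (-1 : ℤ) ^ T.1.card • degeneracyPullback 0 N (8 * N ^ 2) (∏ t ∈ T.1, t - 1 + 1) (ZMod 2)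
              (level_mul_prod_dvd_of_mem_powerset T.2)
              (fun (γ : Gamma0 N) (_ : Fin 1) => φ ⟨cuspSymbol f γ, cuspSymbol_mem_periodLattice f γ⟩) γ = 0) →
        ∀ γ : Gamma0 N, φ ⟨cuspSymbol f γ, cuspSymbol_mem_periodLattice f γ⟩ = 0) :
    MultiShiftClassGenerationTwo := by
  rw [multiShiftClassGenerationTwo_iff_functionals]
  intro W _ N _ f hf h4 hirr φ hφ
  set G : Finset ℕ := insert 8 (N.primeFactors.filter fun q => ¬ q ^ 2 ∣ N) with hG
  -- the annihilation relation for `u_φ`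
  have hann : ∀ γ : Gamma0 (8 * N ^ 2),
      ∑ T ∈ G.powerset.attach,
        (-1 : ℤ) ^ T.1.card • degeneracyPullback 0 N (8 * N ^ 2) (∏ t ∈ T.1, t - 1 + 1) (ZMod 2)
          (level_mul_prod_dvd_of_mem_powerset T.2)
          (fun (γ : Gamma0 N) (_ : Fin 1) => φ ⟨cuspSymbol f γ, cuspSymbol_mem_periodLattice f γ⟩) γ = 0 := by
    intro γ
    funext i
    rw [Finset.sum_apply, Pi.zero_apply]
    simp only [Pi.smul_apply, degeneracyPullback_zero_apply]
    -- each term is `(−1)^{|T|} • φ({∞, γ∞}_{f∣ι_T})`; collect inside `φ`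
    have hterm : ∀ T : {T // T ∈ G.powerset},
        (-1 : ℤ) ^ T.1.card • φ ⟨cuspSymbol f (Gamma0.degeneracyConj N (8 * N ^ 2) (∏ t ∈ T.1, t - 1 + 1)
            (level_mul_prod_dvd_of_mem_powerset T.2) γ), cuspSymbol_mem_periodLattice f _⟩ =
          φ ((-1 : ℤ) ^ T.1.card • ⟨cuspSymbol (degeneracyMap0 N (8 * N ^ 2) (∏ t ∈ T.1, t - 1 + 1) 2 f) γ, by
            rw [cuspSymbol_degeneracyMap0 (level_mul_prod_dvd_of_mem_powerset T.2) f γ]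
            exact cuspSymbol_mem_periodLattice f _⟩) := by
      intro T
      rw [map_zsmul]
      congr 2
      apply Subtype.ext
      exact (cuspSymbol_degeneracyMap0 (level_mul_prod_dvd_of_mem_powerset T.2) f γ).symm
    rw [Finset.sum_congr rfl fun T _ => hterm T, ← map_sum]
    apply hφ
    -- the element is `{∞, γ∞}_{h₂}`
    rw [AddSubmonoidClass.coe_finsetSum]
    simp only [AddSubgroupClass.coe_zsmul, zsmul_eq_mul, Int.cast_pow, Int.cast_neg, Int.cast_one]
    have hsum : ∑ T ∈ G.powerset.attach,
        (-1 : ℂ) ^ T.1.card * cuspSymbol (degeneracyMap0 N (8 * N ^ 2) (∏ t ∈ T.1, t - 1 + 1) 2 f) γ =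
        cuspSymbol (∑ T ∈ G.powerset, (-1 : ℂ) ^ T.card •
          degeneracyMap0 N (8 * N ^ 2) (∏ t ∈ T, t - 1 + 1) 2 f) γ := by
      rw [← periodFunctional_apply, map_sum]
      simp only [map_smul, smul_eq_mul, periodFunctional_apply]
      exact Finset.sum_attach G.powerset
        (fun T => (-1 : ℂ) ^ T.card * cuspSymbol (degeneracyMap0 N (8 * N ^ 2) (∏ t ∈ T, t - 1 + 1) 2 f) γ)
    rw [hsum]
    exact cuspSymbol_mem_periodLattice _ γ
  have hu := H W f hf h4 hirr φ hann
  ext x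
  have hx : (x : ℂ) ∈ (periodLattice f : Set ℂ) := x.2
  rw [coe_periodLattice_eq_range] at hx
  obtain ⟨γ, hγ⟩ := hx
  have : x = ⟨cuspSymbol f γ, cuspSymbol_mem_periodLattice f γ⟩ := Subtype.ext hγ.symm
  rw [this, AddMonoidHom.zero_apply]
  exact hu γ

end Cocycle

end Summit.BirchSwinnertonDyer.BirchSwinnertonDyer.Theorems.ManinLocalTwoThree

end
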